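import Summits.QuantumFields.YangMills.Theorems.ColdStartUniversalityLatticeLangevinMarkovShift
import HarnessLib

/-!
# Route `ColdStartUniversality` (fixed-cut-off SZZ dynamics): ★★★ THE MARKOV PROPERTY OF STRONG SOLUTIONS WITH RESPECT TO
# THE DRIVING FILTRATION — `E[Z · G(U_(s+t))] = E[Z · (κ_t G)(U_s)]` for every `𝓕^W_s`-measurable `Z`

Helper file (seat `ym-line-csu-p1`, g33; `--supports stmt-QuantumFields-24809`).  For the SU(2) lattice Langevin (Shen–Zhu–Zhu) dynamics on
`(ℤ/L)³` at any coupling `β'`, every Markov kernel family `κ` realising the transition laws (`exists_transitionKernel`), EVERY strong solution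
`U` from a deterministic start `x` on ANY probability space `(Ω, P)` with flat Brownian driver `W`, all lattice times `s, t`, every bounded
`Z : Ω → ℝ` measurable for the raw natural filtration `σ(W_u : u ≤ s)` and every bounded measurable observable `G`:

  `∫ Z · G(U_(s+t)) dP = ∫ Z · (∫ G dκ_t(U_s)) dP`     (`integral_mul_comp_add_eq_integral_mul_transition`),

i.e. `E[G(U_(s+t)) | 𝓕^W_s] = (κ_t G)(U_s)` a.s. (`condExp_comp_add_ae_eq_transition`).  Consequences: the JOINT LAW of `(U_s, U_(s+t))` is the
composition-product `κ_s(x,·) ⊗ₘ κ_t` (`map_pair_eq_compProd`), `∫ H(U_s, U_(s+t)) dP = ∫∫ H(y,z) κ_t(y,dz) κ_s(x,dy)` for bounded measurable `H`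
(`integral_pair_eq_integral_transition`), and the two-time factorisation `E[F(U_s)G(U_(s+t))] = ∫ F·(κ_tG) dκ_s(x)` (`integral_mul_comp_add_eq_transition`)
— the solution form that the kernel-form space-time statements of the Lieb–Robinson package (file 43) were waiting for.

Proof: (1) at DYADIC `s` on the given space: the canonical flow `Uc` of `cocycle_dyadic` (built on the path space of `W` itself) realises `U`
(`U_t = Uc x t ∘ pathMap` for all `t` a.s., pathwise uniqueness), the cocycle `Uc x (s+t) = Uc (Uc x s) t ∘ θ_s` pulls back to `Ω`, and the
`𝓕_s`-measurable pair `(Z, U_s)` is frozen against the independent shifted path `θ_s` (law = the canonical law; `indepFun_shiftPath_of_measurable`,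
`map_shiftPath_eq`, `IsBrownianVec.integral_comp_eq_integral_integral_of_indepFun`); (2) all `s`, continuous `G`: dyadic approximation FROM ABOVE
(`Z` stays measurable), a.s. path continuity and the Feller property (`continuous_integral_transitionKernel`); (3) measurable `G`: the two sides are
finite measures in `G` agreeing on bounded continuous functions (`ext_of_forall_integral_eq_of_IsFiniteMeasure`); the joint law by uniqueness of
measures on the product π-system.  THEOREMS ONLY, no definition, no sorry; [folklore] (Revuz–Yor IX (1.7)/III (1.5)-type statements for this SDE).
HONEST FRAMING: fixed cut-off; structural plumbing; `UniformColdStartMixing` (24809) is NOT restated; no crux, rung or summit statement is proved;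
the Yang–Mills mass gap is NOT proved.
-/

set_option autoImplicit false

noncomputable section

namespace Summit.QuantumFields.YangMills.Theorems.ColdStartUniversality

open MeasureTheory ProbabilityTheory Filter Topology
open scoped NNReal ENNReal BigOperators
open Literature Literature.Probability.Process Literature.MathematicalPhysics.QuantumFieldTheory
open Literature.MathematicalPhysics.QuantumLattice (fundamentalRep fundamentalLatticeRep continuous_fundamentalRep)

variable {L : ℕ} [NeZero L]

/-! ## §1. The Markov property at dyadic times (cocycle + freezing), on an arbitrary space -/

/-- **Markov property at a dyadic time `s = k₀/2^m₀`.**  For every strong solution `U` from a deterministic start on any space, every bounded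
`Z` measurable for `σ(W_u : u ≤ s)` and every bounded measurable `G`: `∫ Z·G(U_(s+t)) dP = ∫ Z·(∫ G dκ_t(U_s)) dP`.
[cite: RevuzYor1999, Ch. IX Thm (1.7)] -/
theorem integral_mul_comp_add_eq_integral_mul_transition_dyadic (β' : ℝ) (k₀ m₀ : ℕ) (t : ℝ≥0)
    (κ : ℝ≥0 → Kernel (GaugeConfig 3 L (Matrix.specialUnitaryGroup (Fin 2) ℂ))
      (GaugeConfig 3 L (Matrix.specialUnitaryGroup (Fin 2) ℂ))) [∀ t, IsMarkovKernel (κ t)]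
    (hreal : ∀ (t : ℝ≥0) (x : GaugeConfig 3 L (Matrix.specialUnitaryGroup (Fin 2) ℂ))
        (Ω : Type) [MeasurableSpace Ω] (P : Measure Ω) [IsProbabilityMeasure P]
        (W : ℝ≥0 → Ω → (Edge 3 L × NoiseIdx 2 → ℝ)) (hW : IsFlatBrownian W P)
        (U : ℝ≥0 → Ω → GaugeConfig 3 L (Matrix.specialUnitaryGroup (Fin 2) ℂ)),
        (∀ ω, U 0 ω = x) →
        (latticeLangevinDynamics (fundamentalLatticeRep 2) β').IsSolution (fundamentalRep (Fin 2))
          hW.natFiltration P W U →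
        κ t x = P.map (U t))
    (x : GaugeConfig 3 L (Matrix.specialUnitaryGroup (Fin 2) ℂ))
    {Ω : Type} [MeasurableSpace Ω] {P : Measure Ω} [IsProbabilityMeasure P]
    {W : ℝ≥0 → Ω → (Edge 3 L × NoiseIdx 2 → ℝ)} (hW : IsFlatBrownian W P)
    {U : ℝ≥0 → Ω → GaugeConfig 3 L (Matrix.specialUnitaryGroup (Fin 2) ℂ)} (hU0 : ∀ ω, U 0 ω = x)
    (hU : (latticeLangevinDynamics (fundamentalLatticeRep 2) β').IsSolution (fundamentalRep (Fin 2)) hW.natFiltration P W U)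
    {Z : Ω → ℝ} (hZ : Measurable[hW.natFiltration ((k₀ : ℝ≥0) / 2 ^ m₀)] Z) {CZ : ℝ} (hZb : ∀ ω, |Z ω| ≤ CZ)
    {G : GaugeConfig 3 L (Matrix.specialUnitaryGroup (Fin 2) ℂ) → ℝ} (hG : Measurable G) {CG : ℝ} (hGb : ∀ z, |G z| ≤ CG) :
    ∫ ω, Z ω * G (U ((k₀ : ℝ≥0) / 2 ^ m₀ + t) ω) ∂P = ∫ ω, Z ω * (∫ z, G z ∂(κ t (U ((k₀ : ℝ≥0) / 2 ^ m₀) ω))) ∂P := by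
  classical
  set s : ℝ≥0 := (k₀ : ℝ≥0) / 2 ^ m₀ with hs
  -- the canonical space over the path space of `W`
  set π : Ω → {p : ℝ≥0 → (Edge 3 L × NoiseIdx 2 → ℝ) // Continuous p ∧ p 0 = 0} :=
    fun ω => ⟨fun t => W t ω, continuous_path_and_zero hW ω⟩ with hπ
  have hπm : Measurable π := measurable_pathMap hW
  set Pc : Measure {p : ℝ≥0 → (Edge 3 L × NoiseIdx 2 → ℝ) // Continuous p ∧ p 0 = 0} := P.map π with hPc
  haveI : IsProbabilityMeasure Pc := Measure.isProbabilityMeasure_map hπm.aemeasurable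
  have hWc := isFlatBrownian_canonical hW
  -- the canonical flow with the cocycle property at dyadic times
  obtain ⟨Uc, hUc, hmeas, hcoc⟩ := cocycle_dyadic hW β'
  have hmUc : ∀ y u, Measurable (Uc y u) := fun y u => ((hUc y).2.adapted u).mono (hWc.natFiltration.le u) le_rfl
  have hκ : ∀ u y, κ u y = Pc.map (Uc y u) := fun u y => hreal u y _ Pc _ hWc (Uc y) (hUc y).1 (hUc y).2
  -- `U = Uc x ∘ π` for all times, a.s. (pathwise uniqueness on `Ω`)
  have hsolc : (latticeLangevinDynamics (fundamentalLatticeRep 2) β').IsSolution (fundamentalRep (Fin 2))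
      hW.natFiltration P W (fun u ω => Uc x u (π ω)) :=
    isSolution_comp hW hWc hπm rfl (fun _ _ => rfl) β' (hUc x).2
  have hUeq : ∀ᵐ ω ∂P, ∀ u, U u ω = Uc x u (π ω) :=
    latticeLangevin_pathwise_unique hW β' x hU0 (fun ω => (hUc x).1 _) hU hsolc
  -- the shifted path and the cocycle pulled back to `Ω`
  set θ : Ω → {p : ℝ≥0 → (Edge 3 L × NoiseIdx 2 → ℝ) // Continuous p ∧ p 0 = 0} :=
    fun ω => ⟨fun u => W (s + u) ω - W s ω, continuous_shiftPath_and_zero hW s ω⟩ with hθ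
  have hθm : Measurable θ := (measurable_pi_lambda _ fun u => ((isFlatBrownian_shift hW s).measurable u)).subtype_mk
  have hθlaw : P.map θ = Pc := map_shiftPath_eq hW s
  have hcocΩ : ∀ᵐ ω ∂P, Uc x (s + t) (π ω) = Uc (Uc x s (π ω)) t (θ ω) := by
    have h1 := hcoc x k₀ m₀ t
    exact ae_of_ae_map hπm.aemeasurable h1
  -- freezing the `𝓕_s`-measurable pair `(Z, U_s)` against the independent shifted path
  have hmUs : Measurable[hW.natFiltration s] (U s) := hU.adapted s
  have hY : Measurable[hW.natFiltration s] (fun ω => (Z ω, U s ω)) := hZ.prodMk hmUs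
  have hind := indepFun_shiftPath_of_measurable hW s hY
  have hYm : Measurable (fun ω => (Z ω, U s ω)) := hY.mono (hW.natFiltration.le s) le_rfl
  set g : (ℝ × GaugeConfig 3 L (Matrix.specialUnitaryGroup (Fin 2) ℂ)) ×
      {p : ℝ≥0 → (Edge 3 L × NoiseIdx 2 → ℝ) // Continuous p ∧ p 0 = 0} → ℝ :=
    fun q => max (-CZ) (min q.1.1 CZ) * G (Uc q.1.2 t q.2) with hg
  have hgm : Measurable g :=
    (measurable_const.max ((measurable_fst.comp measurable_fst).min measurable_const)).mul
      (hG.comp ((hmeas t).comp ((measurable_snd.comp measurable_fst).prodMk measurable_snd)))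
  have hclamp : ∀ r : ℝ, |max (-CZ) (min r CZ)| ≤ |CZ| := fun r =>
    abs_le.2 ⟨(neg_le_neg (le_abs_self CZ)).trans (le_max_left _ _),
      max_le ((neg_le_abs CZ)) ((min_le_right _ _).trans (le_abs_self CZ))⟩
  have hclampZ : ∀ ω, max (-CZ) (min (Z ω) CZ) = Z ω := fun ω => by
    have h := abs_le.1 (hZb ω)
    rw [min_eq_left h.2, max_eq_right h.1]
  have hgb : ∀ q, |g q| ≤ |CZ| * CG := fun q => by
    rw [hg, abs_mul]
    exact mul_le_mul (hclamp _) (hGb _) (abs_nonneg _) (abs_nonneg _)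
  have hfreeze := IsBrownianVec.integral_comp_eq_integral_integral_of_indepFun hYm hθm hind hgm hgb
  rw [hθlaw] at hfreeze
  -- left side: `Z ω * G (U (s+t) ω) = g ((Z ω, U s ω), θ ω)` a.s.
  have hL : ∫ ω, Z ω * G (U (s + t) ω) ∂P = ∫ ω, g ((Z ω, U s ω), θ ω) ∂P := by
    refine integral_congr_ae ?_
    filter_upwards [hUeq, hcocΩ] with ω hω hc
    show Z ω * G (U (s + t) ω) = max (-CZ) (min (Z ω) CZ) * G (Uc (U s ω) t (θ ω))
    rw [hclampZ ω, hω (s + t), hc, ← hω s]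
  -- right side: the inner integral is `Z ω * ∫ G dκ_t(U s ω)`
  have hR : ∀ ω, ∫ e, g ((Z ω, U s ω), e) ∂Pc = Z ω * ∫ z, G z ∂(κ t (U s ω)) := by
    intro ω
    show ∫ e, max (-CZ) (min (Z ω) CZ) * G (Uc (U s ω) t e) ∂Pc = _
    rw [integral_const_mul, hclampZ ω, hκ t (U s ω), integral_map (hmUc _ t).aemeasurable hG.aestronglyMeasurable]
  rw [hL, hfreeze]
  exact integral_congr_ae (ae_of_all _ fun ω => hR ω)

/-! ## §2. Dyadic approximation of a time from above -/

/-- The dyadic ceiling `(⌊s·2^m⌋ + 1)/2^m` lies in `[s, s + 2^(−m)]`. [folklore] -/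
theorem le_dyadicCeil_and_le (s : ℝ≥0) (m : ℕ) :
    s ≤ ((⌊(s : ℝ) * 2 ^ m⌋₊ + 1 : ℕ) : ℝ≥0) / 2 ^ m ∧
      ((⌊(s : ℝ) * 2 ^ m⌋₊ + 1 : ℕ) : ℝ≥0) / 2 ^ m ≤ s + (2⁻¹ : ℝ≥0) ^ m := by
  have h2 : (0 : ℝ) < 2 ^ m := by positivity
  constructor
  · rw [← NNReal.coe_le_coe, NNReal.coe_div, NNReal.coe_natCast, NNReal.coe_pow, NNReal.coe_ofNat, le_div_iff₀ h2]
    push_cast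
    exact (Nat.lt_floor_add_one ((s : ℝ) * 2 ^ m)).le
  · rw [← NNReal.coe_le_coe, NNReal.coe_div, NNReal.coe_natCast, NNReal.coe_pow, NNReal.coe_ofNat, div_le_iff₀ h2,
      NNReal.coe_add, NNReal.coe_pow, NNReal.coe_inv, NNReal.coe_ofNat, add_mul, inv_pow, inv_mul_cancel₀ h2.ne']
    push_cast
    have h0 : (0 : ℝ) ≤ (s : ℝ) * 2 ^ m := by positivity
    linarith [Nat.floor_le h0]

/-- The dyadic ceilings converge to `s`. [folklore] -/
theorem tendsto_dyadicCeil (s : ℝ≥0) :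
    Tendsto (fun m : ℕ => ((⌊(s : ℝ) * 2 ^ m⌋₊ + 1 : ℕ) : ℝ≥0) / 2 ^ m) atTop (𝓝 s) := by
  have hup : Tendsto (fun m : ℕ => s + (2⁻¹ : ℝ≥0) ^ m) atTop (𝓝 s) := by
    have h := (NNReal.tendsto_pow_atTop_nhds_zero_of_lt_one (by norm_num : (2⁻¹ : ℝ≥0) < 1))
    simpa using tendsto_const_nhds.add h
  exact tendsto_of_tendsto_of_tendsto_of_le_of_le tendsto_const_nhds hup (fun m => (le_dyadicCeil_and_le s m).1)
    fun m => (le_dyadicCeil_and_le s m).2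

/-! ## §3. All times, continuous observables: path continuity and the Feller property -/

/-- **Markov property, every time `s`, continuous observable.**  For every strong solution `U` from a deterministic start, every bounded
`Z` measurable for `σ(W_u : u ≤ s)` and every continuous `G`: `∫ Z·G(U_(s+t)) dP = ∫ Z·(∫ G dκ_t(U_s)) dP` (dyadic times `s_m ↓ s`, for which
`Z` stays `𝓕_(s_m)`-measurable; a.s. continuity of the paths of `U`; Feller continuity of `κ_t G`). [cite: RevuzYor1999, Ch. IX Thm (1.7)] -/
theorem integral_mul_comp_add_eq_integral_mul_transition_of_continuous (β' : ℝ)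
    (κ : ℝ≥0 → Kernel (GaugeConfig 3 L (Matrix.specialUnitaryGroup (Fin 2) ℂ))
      (GaugeConfig 3 L (Matrix.specialUnitaryGroup (Fin 2) ℂ))) [∀ t, IsMarkovKernel (κ t)]
    (hreal : ∀ (t : ℝ≥0) (x : GaugeConfig 3 L (Matrix.specialUnitaryGroup (Fin 2) ℂ))
        (Ω : Type) [MeasurableSpace Ω] (P : Measure Ω) [IsProbabilityMeasure P]
        (W : ℝ≥0 → Ω → (Edge 3 L × NoiseIdx 2 → ℝ)) (hW : IsFlatBrownian W P)
        (U : ℝ≥0 → Ω → GaugeConfig 3 L (Matrix.specialUnitaryGroup (Fin 2) ℂ)),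
        (∀ ω, U 0 ω = x) →
        (latticeLangevinDynamics (fundamentalLatticeRep 2) β').IsSolution (fundamentalRep (Fin 2))
          hW.natFiltration P W U →
        κ t x = P.map (U t))
    (x : GaugeConfig 3 L (Matrix.specialUnitaryGroup (Fin 2) ℂ))
    {Ω : Type} [MeasurableSpace Ω] {P : Measure Ω} [IsProbabilityMeasure P]
    {W : ℝ≥0 → Ω → (Edge 3 L × NoiseIdx 2 → ℝ)} (hW : IsFlatBrownian W P)
    {U : ℝ≥0 → Ω → GaugeConfig 3 L (Matrix.specialUnitaryGroup (Fin 2) ℂ)} (hU0 : ∀ ω, U 0 ω = x)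
    (hU : (latticeLangevinDynamics (fundamentalLatticeRep 2) β').IsSolution (fundamentalRep (Fin 2)) hW.natFiltration P W U)
    (s t : ℝ≥0) {Z : Ω → ℝ} (hZ : Measurable[hW.natFiltration s] Z) {CZ : ℝ} (hZb : ∀ ω, |Z ω| ≤ CZ)
    {G : GaugeConfig 3 L (Matrix.specialUnitaryGroup (Fin 2) ℂ) → ℝ} (hG : Continuous G) :
    ∫ ω, Z ω * G (U (s + t) ω) ∂P = ∫ ω, Z ω * (∫ z, G z ∂(κ t (U s ω))) ∂P := by
  classical
  haveI := secondCountableTopology_su2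
  haveI := borelSpace_config L
  -- `G` is bounded (compact configuration space)
  obtain ⟨CG, hGb⟩ : ∃ CG : ℝ, ∀ z, |G z| ≤ CG := by
    set Gb := BoundedContinuousFunction.mkOfCompact ⟨G, hG⟩ with hGbdef
    exact ⟨‖Gb‖, fun z => by simpa [hGbdef, Real.norm_eq_abs] using Gb.norm_coe_le_norm z⟩
  have hGm : Measurable G := hG.measurable
  -- dyadic times from above
  set sm : ℕ → ℝ≥0 := fun m => ((⌊(s : ℝ) * 2 ^ m⌋₊ + 1 : ℕ) : ℝ≥0) / 2 ^ m with hsm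
  have hsm_ge : ∀ m, s ≤ sm m := fun m => (le_dyadicCeil_and_le s m).1
  have hsm_lim : Tendsto sm atTop (𝓝 s) := tendsto_dyadicCeil s
  have hZm : ∀ m, Measurable[hW.natFiltration (sm m)] Z := fun m => hZ.mono (hW.natFiltration.mono (hsm_ge m)) le_rfl
  have hstep : ∀ m, ∫ ω, Z ω * G (U (sm m + t) ω) ∂P = ∫ ω, Z ω * (∫ z, G z ∂(κ t (U (sm m) ω))) ∂P := fun m =>
    integral_mul_comp_add_eq_integral_mul_transition_dyadic β' (⌊(s : ℝ) * 2 ^ m⌋₊ + 1) m t κ hreal x hW hU0 hU (hZm m) hZb hGm hGb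
  -- measurability and bounds
  have hZm0 : Measurable Z := hZ.mono (hW.natFiltration.le s) le_rfl
  have hmU : ∀ u : ℝ≥0, Measurable (U u) := fun u => (hU.adapted u).mono (hW.natFiltration.le u) le_rfl
  have hF : Continuous fun y => ∫ z, G z ∂(κ t y) := continuous_integral_transitionKernel L β' κ hreal t hG
  have hFb : ∀ y, |∫ z, G z ∂(κ t y)| ≤ CG := fun y => by
    have h := norm_integral_le_of_norm_le_const (μ := κ t y) (f := G) (C := CG)
      (Eventually.of_forall fun z => by simpa [Real.norm_eq_abs] using hGb z)
    simpa [Real.norm_eq_abs] using h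
  have hbound1 : ∀ m, ∀ᵐ ω ∂P, ‖Z ω * G (U (sm m + t) ω)‖ ≤ |CZ| * CG := fun m =>
    Eventually.of_forall fun ω => by
      rw [norm_mul, Real.norm_eq_abs, Real.norm_eq_abs]
      exact mul_le_mul ((hZb ω).trans (le_abs_self CZ)) (hGb _) (abs_nonneg _) (abs_nonneg _)
  have hbound2 : ∀ m, ∀ᵐ ω ∂P, ‖Z ω * ∫ z, G z ∂(κ t (U (sm m) ω))‖ ≤ |CZ| * CG := fun m =>
    Eventually.of_forall fun ω => by
      rw [norm_mul, Real.norm_eq_abs, Real.norm_eq_abs]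
      exact mul_le_mul ((hZb ω).trans (le_abs_self CZ)) (hFb _) (abs_nonneg _) (abs_nonneg _)
  -- the two limits
  have hL : Tendsto (fun m => ∫ ω, Z ω * G (U (sm m + t) ω) ∂P) atTop (𝓝 (∫ ω, Z ω * G (U (s + t) ω) ∂P)) := by
    refine tendsto_integral_of_dominated_convergence (fun _ => |CZ| * CG)
      (fun m => (hZm0.mul (hGm.comp (hmU _))).aestronglyMeasurable) (integrable_const _) hbound1 ?_
    filter_upwards [hU.continuous] with ω hω
    exact ((hG.tendsto _).comp ((hω.tendsto _).comp (hsm_lim.add tendsto_const_nhds))).const_mul (Z ω)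
  have hR : Tendsto (fun m => ∫ ω, Z ω * (∫ z, G z ∂(κ t (U (sm m) ω))) ∂P) atTop
      (𝓝 (∫ ω, Z ω * (∫ z, G z ∂(κ t (U s ω))) ∂P)) := by
    refine tendsto_integral_of_dominated_convergence (fun _ => |CZ| * CG)
      (fun m => (hZm0.mul (hF.measurable.comp (hmU _))).aestronglyMeasurable) (integrable_const _) hbound2 ?_
    filter_upwards [hU.continuous] with ω hω
    exact ((hF.tendsto _).comp ((hω.tendsto _).comp hsm_lim)).const_mul (Z ω)
  have hLR : (fun m => ∫ ω, Z ω * G (U (sm m + t) ω) ∂P) = fun m => ∫ ω, Z ω * (∫ z, G z ∂(κ t (U (sm m) ω))) ∂P :=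
    funext hstep
  rw [hLR] at hL
  exact tendsto_nhds_unique hL hR

/-! ## §4. All times, measurable observables: the two sides are finite measures in `G` -/

/-- Integration against the image of a weighted measure: `∫ h d((Z·P) ∘ V⁻¹) = ∫ Z · h(V) dP` for a bounded-type density `Z ≥ 0`
(read through `withDensity (ofReal ∘ Z)`). [folklore] -/
theorem integral_map_withDensity_ofReal {Ω X : Type*} [MeasurableSpace Ω] [MeasurableSpace X] {P : Measure Ω}
    {Z : Ω → ℝ} (hZm : Measurable Z) (hZ0 : ∀ ω, 0 ≤ Z ω) {V : Ω → X} (hV : Measurable V)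
    {h : X → ℝ} (hh : Measurable h) :
    ∫ y, h y ∂((P.withDensity fun ω => ENNReal.ofReal (Z ω)).map V) = ∫ ω, Z ω * h (V ω) ∂P := by
  rw [integral_map hV.aemeasurable hh.aestronglyMeasurable,
    integral_withDensity_eq_integral_toReal_smul hZm.ennreal_ofReal
      (Eventually.of_forall fun _ => ENNReal.ofReal_lt_top)]
  refine integral_congr_ae (ae_of_all _ fun ω => ?_)
  show (ENNReal.ofReal (Z ω)).toReal • h (V ω) = Z ω * h (V ω)
  rw [ENNReal.toReal_ofReal (hZ0 ω), smul_eq_mul]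

/-- Markov property for a NON-NEGATIVE bounded `𝓕_s`-measurable weight `Z` and a bounded measurable observable `G` (the two sides, as
functions of `G`, are the finite measures `(Z·P)∘U_(s+t)⁻¹` and `κ_t ∘ₘ (Z·P)∘U_s⁻¹`, which agree on continuous functions by
`integral_mul_comp_add_eq_integral_mul_transition_of_continuous`). [cite: RevuzYor1999, Ch. IX Thm (1.7)] -/
theorem integral_mul_comp_add_eq_integral_mul_transition_of_nonneg (β' : ℝ)
    (κ : ℝ≥0 → Kernel (GaugeConfig 3 L (Matrix.specialUnitaryGroup (Fin 2) ℂ))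
      (GaugeConfig 3 L (Matrix.specialUnitaryGroup (Fin 2) ℂ))) [∀ t, IsMarkovKernel (κ t)]
    (hreal : ∀ (t : ℝ≥0) (x : GaugeConfig 3 L (Matrix.specialUnitaryGroup (Fin 2) ℂ))
        (Ω : Type) [MeasurableSpace Ω] (P : Measure Ω) [IsProbabilityMeasure P]
        (W : ℝ≥0 → Ω → (Edge 3 L × NoiseIdx 2 → ℝ)) (hW : IsFlatBrownian W P)
        (U : ℝ≥0 → Ω → GaugeConfig 3 L (Matrix.specialUnitaryGroup (Fin 2) ℂ)),
        (∀ ω, U 0 ω = x) →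
        (latticeLangevinDynamics (fundamentalLatticeRep 2) β').IsSolution (fundamentalRep (Fin 2))
          hW.natFiltration P W U →
        κ t x = P.map (U t))
    (x : GaugeConfig 3 L (Matrix.specialUnitaryGroup (Fin 2) ℂ))
    {Ω : Type} [MeasurableSpace Ω] {P : Measure Ω} [IsProbabilityMeasure P]
    {W : ℝ≥0 → Ω → (Edge 3 L × NoiseIdx 2 → ℝ)} (hW : IsFlatBrownian W P)
    {U : ℝ≥0 → Ω → GaugeConfig 3 L (Matrix.specialUnitaryGroup (Fin 2) ℂ)} (hU0 : ∀ ω, U 0 ω = x)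
    (hU : (latticeLangevinDynamics (fundamentalLatticeRep 2) β').IsSolution (fundamentalRep (Fin 2)) hW.natFiltration P W U)
    (s t : ℝ≥0) {Z : Ω → ℝ} (hZ : Measurable[hW.natFiltration s] Z) (hZ0 : ∀ ω, 0 ≤ Z ω) {CZ : ℝ} (hZb : ∀ ω, |Z ω| ≤ CZ)
    {G : GaugeConfig 3 L (Matrix.specialUnitaryGroup (Fin 2) ℂ) → ℝ} (hG : Measurable G) {CG : ℝ} (hGb : ∀ z, |G z| ≤ CG) :
    ∫ ω, Z ω * G (U (s + t) ω) ∂P = ∫ ω, Z ω * (∫ z, G z ∂(κ t (U s ω))) ∂P := by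
  classical
  haveI := secondCountableTopology_su2
  haveI := borelSpace_config L
  haveI := polishSpace_config L
  have hZm0 : Measurable Z := hZ.mono (hW.natFiltration.le s) le_rfl
  have hmU : ∀ u : ℝ≥0, Measurable (U u) := fun u => (hU.adapted u).mono (hW.natFiltration.le u) le_rfl
  -- the weighted measure `Z·P` and the two image measures
  set μZ : Measure Ω := P.withDensity fun ω => ENNReal.ofReal (Z ω) with hμZ
  haveI : IsFiniteMeasure μZ := by
    refine isFiniteMeasure_withDensity_ofReal ?_
    exact ((integrable_const CZ).mono' hZm0.aestronglyMeasurable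
      (Eventually.of_forall fun ω => by simpa [Real.norm_eq_abs] using hZb ω)).hasFiniteIntegral
  set ν₁ : Measure (GaugeConfig 3 L (Matrix.specialUnitaryGroup (Fin 2) ℂ)) := μZ.map (U (s + t)) with hν₁
  set ν₂ : Measure (GaugeConfig 3 L (Matrix.specialUnitaryGroup (Fin 2) ℂ)) := κ t ∘ₘ μZ.map (U s) with hν₂
  haveI : IsFiniteMeasure ν₁ := Measure.isFiniteMeasure_map _ _
  haveI : IsFiniteMeasure (μZ.map (U s)) := Measure.isFiniteMeasure_map _ _
  haveI : IsFiniteMeasure ν₂ := by rw [hν₂]; infer_instance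
  -- bounded measurable functions are integrable for these finite measures; kernel actions are measurable
  have hκm : ∀ {φ : GaugeConfig 3 L (Matrix.specialUnitaryGroup (Fin 2) ℂ) → ℝ}, Measurable φ →
      Measurable fun y => ∫ z, φ z ∂(κ t y) := fun hφ => (hφ.stronglyMeasurable.integral_kernel (κ := κ t)).measurable
  have hintν₂ : ∀ {φ : GaugeConfig 3 L (Matrix.specialUnitaryGroup (Fin 2) ℂ) → ℝ}, Measurable φ → ∀ {C : ℝ}, (∀ z, |φ z| ≤ C) →
      Integrable φ ν₂ := fun hφ C hC =>
    (integrable_const C).mono' hφ.aestronglyMeasurable (Eventually.of_forall fun z => by simpa [Real.norm_eq_abs] using hC z)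
  -- the two measures agree on bounded continuous functions, hence are equal
  have key : ν₁ = ν₂ := by
    refine ext_of_forall_integral_eq_of_IsFiniteMeasure fun f => ?_
    obtain ⟨Cf, hCf⟩ : ∃ C : ℝ, ∀ z, |f z| ≤ C := ⟨‖f‖, fun z => by simpa [Real.norm_eq_abs] using f.norm_coe_le_norm z⟩
    rw [hν₁, integral_map_withDensity_ofReal hZm0 hZ0 (hmU _) f.continuous.measurable, hν₂,
      Harris.integral_comp_measure (κ t) _ (hintν₂ f.continuous.measurable hCf),
      integral_map_withDensity_ofReal hZm0 hZ0 (hmU s) (hκm f.continuous.measurable)]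
    exact integral_mul_comp_add_eq_integral_mul_transition_of_continuous β' κ hreal x hW hU0 hU s t hZ hZb f.continuous
  -- read the identity for `G` off the equality of measures
  calc ∫ ω, Z ω * G (U (s + t) ω) ∂P = ∫ z, G z ∂ν₁ := by
        rw [hν₁, integral_map_withDensity_ofReal hZm0 hZ0 (hmU _) hG]
    _ = ∫ z, G z ∂ν₂ := by rw [key]
    _ = ∫ y, ∫ z, G z ∂(κ t y) ∂(μZ.map (U s)) := by
        rw [hν₂]; exact Harris.integral_comp_measure (κ t) _ (hintν₂ hG hGb)
    _ = ∫ ω, Z ω * (∫ z, G z ∂(κ t (U s ω))) ∂P := integral_map_withDensity_ofReal hZm0 hZ0 (hmU s) (hκm hG)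

/-- ★★★ **THE MARKOV PROPERTY OF STRONG SOLUTIONS OF THE SZZ DYNAMICS WITH RESPECT TO THE DRIVING FILTRATION.**  For every coupling,
every Markov kernel family `κ` realising the transition laws, EVERY strong solution `U` from a deterministic start `x` on ANY probability space
with flat Brownian driver `W`, all lattice times `s, t`, every bounded `Z` measurable for `σ(W_u : u ≤ s)` and every bounded measurable `G`:
`∫ Z · G(U_(s+t)) dP = ∫ Z · (∫ G dκ_t(U_s)) dP`. [cite: RevuzYor1999, Ch. IX Thm (1.7)] -/
theorem integral_mul_comp_add_eq_integral_mul_transition (β' : ℝ)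
    (κ : ℝ≥0 → Kernel (GaugeConfig 3 L (Matrix.specialUnitaryGroup (Fin 2) ℂ))
      (GaugeConfig 3 L (Matrix.specialUnitaryGroup (Fin 2) ℂ))) [∀ t, IsMarkovKernel (κ t)]
    (hreal : ∀ (t : ℝ≥0) (x : GaugeConfig 3 L (Matrix.specialUnitaryGroup (Fin 2) ℂ))
        (Ω : Type) [MeasurableSpace Ω] (P : Measure Ω) [IsProbabilityMeasure P]
        (W : ℝ≥0 → Ω → (Edge 3 L × NoiseIdx 2 → ℝ)) (hW : IsFlatBrownian W P)
        (U : ℝ≥0 → Ω → GaugeConfig 3 L (Matrix.specialUnitaryGroup (Fin 2) ℂ)),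
        (∀ ω, U 0 ω = x) →
        (latticeLangevinDynamics (fundamentalLatticeRep 2) β').IsSolution (fundamentalRep (Fin 2))
          hW.natFiltration P W U →
        κ t x = P.map (U t))
    (x : GaugeConfig 3 L (Matrix.specialUnitaryGroup (Fin 2) ℂ))
    {Ω : Type} [MeasurableSpace Ω] {P : Measure Ω} [IsProbabilityMeasure P]
    {W : ℝ≥0 → Ω → (Edge 3 L × NoiseIdx 2 → ℝ)} (hW : IsFlatBrownian W P)
    {U : ℝ≥0 → Ω → GaugeConfig 3 L (Matrix.specialUnitaryGroup (Fin 2) ℂ)} (hU0 : ∀ ω, U 0 ω = x)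
    (hU : (latticeLangevinDynamics (fundamentalLatticeRep 2) β').IsSolution (fundamentalRep (Fin 2)) hW.natFiltration P W U)
    (s t : ℝ≥0) {Z : Ω → ℝ} (hZ : Measurable[hW.natFiltration s] Z) {CZ : ℝ} (hZb : ∀ ω, |Z ω| ≤ CZ)
    {G : GaugeConfig 3 L (Matrix.specialUnitaryGroup (Fin 2) ℂ) → ℝ} (hG : Measurable G) {CG : ℝ} (hGb : ∀ z, |G z| ≤ CG) :
    ∫ ω, Z ω * G (U (s + t) ω) ∂P = ∫ ω, Z ω * (∫ z, G z ∂(κ t (U s ω))) ∂P := by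
  have hmU : ∀ u : ℝ≥0, Measurable (U u) := fun u => (hU.adapted u).mono (hW.natFiltration.le u) le_rfl
  have hZm0 : Measurable Z := hZ.mono (hW.natFiltration.le s) le_rfl
  -- shift `Z` to a non-negative weight and subtract the constant
  have hZ' : Measurable[hW.natFiltration s] fun ω => Z ω + CZ := hZ.add_const CZ
  have hZ'0 : ∀ ω, 0 ≤ Z ω + CZ := fun ω => by linarith [(abs_le.1 (hZb ω)).1]
  have hZ'b : ∀ ω, |Z ω + CZ| ≤ CZ + |CZ| := fun ω => (abs_add_le _ _).trans (add_le_add (hZb ω) le_rfl)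
  have hC0 : ∀ ω : Ω, 0 ≤ CZ := fun ω => (abs_nonneg _).trans (hZb ω)
  have h1 := integral_mul_comp_add_eq_integral_mul_transition_of_nonneg β' κ hreal x hW hU0 hU s t hZ' hZ'0 hZ'b hG hGb
  have h2 := integral_mul_comp_add_eq_integral_mul_transition_of_nonneg β' κ hreal x hW hU0 hU s t
    (measurable_const (a := CZ)) hC0 (fun _ => le_rfl) hG hGb
  -- integrability of the four bounded products
  have hκGm : Measurable fun y => ∫ z, G z ∂(κ t y) := (hG.stronglyMeasurable.integral_kernel (κ := κ t)).measurable
  have hκGb : ∀ y, |∫ z, G z ∂(κ t y)| ≤ CG := fun y => by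
    have h := norm_integral_le_of_norm_le_const (μ := κ t y) (f := G) (C := CG)
      (Eventually.of_forall fun z => by simpa [Real.norm_eq_abs] using hGb z)
    simpa [Real.norm_eq_abs] using h
  have hInt : ∀ {φ ψ : Ω → ℝ} {Cφ Cψ : ℝ}, Measurable φ → Measurable ψ → (∀ ω, |φ ω| ≤ Cφ) → (∀ ω, |ψ ω| ≤ Cψ) →
      Integrable (fun ω => φ ω * ψ ω) P := fun hφ hψ hφb hψb =>
    (integrable_const _).mono' (hφ.mul hψ).aestronglyMeasurable (Eventually.of_forall fun ω => by
      rw [norm_mul, Real.norm_eq_abs, Real.norm_eq_abs]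
      exact mul_le_mul (hφb ω) (hψb ω) (abs_nonneg _) ((abs_nonneg _).trans (hφb ω)))
  have i1 : Integrable (fun ω => (Z ω + CZ) * G (U (s + t) ω)) P := hInt (hZm0.add_const CZ) (hG.comp (hmU (s + t))) hZ'b (fun ω => hGb _)
  have i2 : Integrable (fun ω => CZ * G (U (s + t) ω)) P := hInt (measurable_const (a := CZ)) (hG.comp (hmU (s + t))) (fun _ => le_rfl) (fun ω => hGb _)
  have i3 : Integrable (fun ω => (Z ω + CZ) * (∫ z, G z ∂(κ t (U s ω)))) P := hInt (hZm0.add_const CZ) (hκGm.comp (hmU s)) hZ'b (fun ω => hκGb _)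
  have i4 : Integrable (fun ω => CZ * (∫ z, G z ∂(κ t (U s ω)))) P := hInt (measurable_const (a := CZ)) (hκGm.comp (hmU s)) (fun _ => le_rfl) (fun ω => hκGb _)
  have eL : ∫ ω, Z ω * G (U (s + t) ω) ∂P =
      (∫ ω, (Z ω + CZ) * G (U (s + t) ω) ∂P) - ∫ ω, CZ * G (U (s + t) ω) ∂P := by
    rw [← integral_sub i1 i2]
    exact integral_congr_ae (ae_of_all _ fun ω => by ring)
  have eR : ∫ ω, Z ω * (∫ z, G z ∂(κ t (U s ω))) ∂P =
      (∫ ω, (Z ω + CZ) * (∫ z, G z ∂(κ t (U s ω))) ∂P) - ∫ ω, CZ * (∫ z, G z ∂(κ t (U s ω))) ∂P := by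
    rw [← integral_sub i3 i4]
    exact integral_congr_ae (ae_of_all _ fun ω => by ring)
  rw [eL, eR, h1, h2]

end Summit.QuantumFields.YangMills.Theorems.ColdStartUniversality

end
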